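import Summits.QuantumAdvantage.QuantumAdvantage.Theses.BochnerSampling
import Summits.QuantumAdvantage.QuantumAdvantage.Theses.Shor
import Literature.Computability.QuantumComplexity.BQPEqBPPIff
import Literature.Computability.QuantumComplexity.BQPSubsetPP
import Literature.Computability.Complexity.CircuitClassesUniformProofs
import Literature.Computability.Complexity.Nondeterministic
import Literature.Barriers.QuantumAdvantage.SeparationPrerequisitesProofs

/-!
# `GraphHSPHard` — typed decomposition attempts (crux-strategist STRATEGY-CENSUS, BC2-redirect audit)

Crux item `stmt-QuantumAdvantage-2621`, decl
`Summit.QuantumAdvantage.QuantumAdvantage.Theses.BochnerSampling.GraphHSPHard` (deciding crux of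
route-QuantumAdvantage-BochnerSampling; also the target of route-QuantumAdvantage-AreaUncertainty).

This file TYPES every decomposition `X₁ ∧ … ∧ X_k → GraphHSPHard` recorded in
`STRATEGY-CENSUS.md` §Decomposition, PROVES each assembly (all seams are pure logic, flag
`trivial_seam`), and records the landed implications that make some pieces summit-strength.
Nothing here is a route item; nothing is proposed to `Theorems/`.  The per-piece BC2 probes
(`Xᵢ → S`, `Xᵢ → X`, `first | exact? | simpa | aesop` must FAIL) live in `bc/*_probe.lean`.

Pieces (k, assembly theorem):
* A  `DLogGraphHiding ∧ DLogSlopeBitsNotBPP → X`            (`graphHSPHard_of_dlog`)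
* B  `DLogGraphHiding ∧ DLogSlopeNotFBPP ∧ DLogSearchToDecision → X` (`graphHSPHard_of_search`)
* C  `NPNotSubsetBPP ∧ HardnessFromNP → X`                    (`graphHSPHard_of_np`)
* E  `ClassSeparation ∧ AdvantageIsCoset → X`                 (`graphHSPHard_of_class`)
* H  `Shor.ShorThesis ∧ HardnessFromFactoring → X`            (`graphHSPHard_of_factoring`)
* I  `DLogGraphHiding ∧ DLogSlopeBitsNotPPoly → X`           (`graphHSPHard_of_ppoly`)
* J  `CountingSeparation ∧ HardnessFromCounting → X`          (`graphHSPHard_of_counting`)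
and the negation-side floor statement `ExactHidingFloor` (typed, not proved here).
(`D` is untypable today, `F` false in print, `G` a costume, `K` not instantiable — see the census.)
-/

noncomputable section

namespace Summit.QuantumAdvantage.QuantumAdvantage.Cruxes.GraphHSPHard.Decomp

open _root_.Computability (encodeNat)
open Literature.Computability.Complexity (FP BPP PPoly UP coUP boolPair RandAlg)
open Summit.QuantumAdvantage.QuantumAdvantage.Theses.BochnerSampling (GraphHSPHard GraphHSPInBQP)

/-! ## The two halves of `GraphHSPHard` as predicates -/

/-- The HIDING conjuncts of `GraphHSPHard` for a triple `(F, Nf, d)`: `F ∈ FP`, `x ↦ ⟨Nf x⟩ ∈ FP`,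
`2 ≤ Nf x`, `d x < Nf x`, and `(a,b) ↦ F ⟨x,⟨a,b⟩⟩` separates exactly the cosets of the graph
subgroup `{(d_x t, t)}` of `(ℤ/Nf x)²` (verbatim from the crux signature). -/
def HidesGraph (F : List Bool → List Bool) (Nf d : List Bool → ℕ) : Prop :=
  F ∈ FP ∧ (fun x => encodeNat (Nf x)) ∈ FP ∧ (∀ x, 2 ≤ Nf x ∧ d x < Nf x) ∧
  (∀ x, ∀ a b a' b' : ℕ, a < Nf x → b < Nf x → a' < Nf x → b' < Nf x →
    (F (boolPair x (boolPair (encodeNat a) (encodeNat b))) =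
      F (boolPair x (boolPair (encodeNat a') (encodeNat b'))) ↔
     ((a : ZMod (Nf x)) - (d x : ZMod (Nf x)) * b = (a' : ZMod (Nf x)) - (d x : ZMod (Nf x)) * b')))

/-- The SLOPE-BIT language `{⟨x, i⟩ : bit i of d x = 1}` of a slope function `d` (verbatim). -/
def slopeBits (d : List Bool → ℕ) : Language Bool :=
  {w : List Bool | ∃ (x : List Bool) (i : ℕ), w = boolPair x (encodeNat i) ∧ (d x).testBit i = true}

/-- `GraphHSPHard` is literally `∃ (F, Nf, d), HidesGraph F Nf d ∧ slopeBits d ∉ BPP`. -/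
theorem graphHSPHard_iff :
    GraphHSPHard ↔ ∃ (F : List Bool → List Bool) (Nf d : List Bool → ℕ),
      HidesGraph F Nf d ∧ slopeBits d ∉ BPP := by
  constructor
  · rintro ⟨F, Nf, d, h1, h2, h3, h4, h5⟩
    exact ⟨F, Nf, d, ⟨h1, h2, h3, h4⟩, h5⟩
  · rintro ⟨F, Nf, d, ⟨h1, h2, h3, h4⟩, h5⟩
    exact ⟨F, Nf, d, h1, h2, h3, h4, h5⟩

/-! ## Decomposition A — instantiate by discrete logarithms in prime-order subgroups of `(ℤ/p)ˣ`

`X₁ = DLogGraphHiding` (a CONSTRUCTION: provable-now in principle from tree lemmas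
`modExpFn_mem_FP`, `PRIMES_mem_P'` (AKS), `boolUnpair`, cyclic-group algebra) and
`X₂ = DLogSlopeBitsNotBPP` (the discrete-logarithm assumption, bit/decision form).
The shared witness is the noncomputable slope function `dlogSlope`. -/

/-- `(p, q, g, y)` is a prime-order-subgroup discrete-log instance: `p, q` prime, `q ∣ p - 1`,
`1 < g < p` with `g ^ q ≡ 1 (mod p)` (so `g` has exact order `q`), and `0 < y < p` with
`y ^ q ≡ 1 (mod p)` (for prime `p` the `q`-torsion of `(ℤ/p)ˣ` is cyclic, so `y ∈ ⟨g⟩`).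
Validity is decidable in P (`PRIMES ∈ P` + modular exponentiation), which is what lets the
hiding family map malformed inputs to the trivial slope. [Shor1997 §6; Schnorr subgroups] -/
def IsSubgroupDLogInstance (p q g y : ℕ) : Prop :=
  p.Prime ∧ q.Prime ∧ q ∣ p - 1 ∧ 1 < g ∧ g < p ∧ Nat.ModEq p (g ^ q) 1 ∧
    0 < y ∧ y < p ∧ Nat.ModEq p (y ^ q) 1

/-- The Boolean encoding `⟨p, ⟨q, ⟨g, y⟩⟩⟩` of an instance. -/
def encodeSubgroupDLogInstance (p q g y : ℕ) : List Bool :=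
  boolPair (encodeNat p) (boolPair (encodeNat q) (boolPair (encodeNat g) (encodeNat y)))

/-- `x` is the canonical encoding of a valid instance `t = (p, q, g, y, a)` together with its
discrete logarithm `a < q`, `g ^ a ≡ y (mod p)`. -/
def IsDLogWitness (x : List Bool) (t : ℕ × ℕ × ℕ × ℕ × ℕ) : Prop :=
  x = encodeSubgroupDLogInstance t.1 t.2.1 t.2.2.1 t.2.2.2.1 ∧
    IsSubgroupDLogInstance t.1 t.2.1 t.2.2.1 t.2.2.2.1 ∧
    t.2.2.2.2 < t.2.1 ∧ Nat.ModEq t.1 (t.2.2.1 ^ t.2.2.2.2) t.2.2.2.1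

open Classical in
/-- The discrete-logarithm SLOPE function: on the canonical encoding of a valid instance, the
exponent `a < q` with `g ^ a ≡ y (mod p)`; `0` on every other string. -/
def dlogSlope (x : List Bool) : ℕ :=
  if h : ∃ t, IsDLogWitness x t then (Classical.choose h).2.2.2.2 else 0

/-- **X₁ (Decomposition A), construction piece.** Some FP family `F`, with FP modulus `Nf`,
hides EXACTLY the graph subgroup of slope `dlogSlope x` in `(ℤ/Nf x)²` for every `x`
(intended witness: `Nf x = q` and `F ⟨x,⟨a,b⟩⟩ = ⟨g^a · y^{q-b} mod p⟩` on valid `x`;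
`Nf x = 2`, `F ⟨x,⟨a,b⟩⟩ = ⟨a⟩` otherwise). Provable-now in principle (size L, plumbing). -/
def DLogGraphHiding : Prop :=
  ∃ (F : List Bool → List Bool) (Nf : List Bool → ℕ), HidesGraph F Nf dlogSlope

/-- **X₂ (Decomposition A), hardness piece.** The slope-bit language of prime-order-subgroup
discrete logarithms is not in `BPP` — the discrete-logarithm assumption (decision form).
OPEN; hypothesis-type; implies `UP ∩ coUP ⊄ BPP` hence `P ≠ NP` (see `ExactHidingFloor`),
and implies the summit via Shor §6 (tree: `isQSolvable_dlog_holds` for the primitive-root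
form). No plan exists for it anywhere. -/
def DLogSlopeBitsNotBPP : Prop :=
  slopeBits dlogSlope ∉ BPP

/-- Assembly A (trivial seam: `∃`-introduction). -/
theorem graphHSPHard_of_dlog (h₁ : DLogGraphHiding) (h₂ : DLogSlopeBitsNotBPP) : GraphHSPHard := by
  obtain ⟨F, Nf, hF, hN, hb, hsep⟩ := h₁
  exact ⟨F, Nf, dlogSlope, hF, hN, hb, hsep, h₂⟩

/-! ## Decomposition B — refine the hardness piece by search-to-decision -/

/-- A slope function is computable in FUNCTIONAL BPP: some probabilistic polynomial-time
algorithm (tree notion `RandAlg.IsPolyTime`, Gill / Arora–Barak Def. 7.1) outputs `⟨d x⟩`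
with probability `≥ 2/3` on every input. -/
def SlopeInFBPP (d : List Bool → ℕ) : Prop :=
  ∃ A : RandAlg (List Bool) (List Bool), A.IsPolyTime id id ∧ ∀ x, 2 / 3 ≤ A.pr id x {encodeNat (d x)}

/-- **X₂a (Decomposition B).** Search form of the discrete-logarithm assumption: `dlogSlope` is
not computable in functional BPP. OPEN; textbook-equivalent to `DLogSlopeBitsNotBPP`
(polynomially many bit queries with amplification / read the bits off the output). -/
def DLogSlopeNotFBPP : Prop :=
  ¬ SlopeInFBPP dlogSlope

/-- **X₂b (Decomposition B).** Search-to-decision for this family: a BPP decider for the slope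
bits yields a functional-BPP computer of the slope (query the `⌈log₂ q⌉` bits, each amplified to
error `< 1/(3 ⌈log₂ q⌉)`). Provable-now in principle (size M–L, amplification plumbing). -/
def DLogSearchToDecision : Prop :=
  slopeBits dlogSlope ∈ BPP → SlopeInFBPP dlogSlope

/-- Seam of B onto A's hardness piece (contraposition). -/
theorem dlogSlopeBitsNotBPP_of_search (ha : DLogSlopeNotFBPP) (hb : DLogSearchToDecision) :
    DLogSlopeBitsNotBPP :=
  fun hmem => ha (hb hmem)

/-- Assembly B. -/
theorem graphHSPHard_of_search (h₁ : DLogGraphHiding) (ha : DLogSlopeNotFBPP)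
    (hb : DLogSearchToDecision) : GraphHSPHard :=
  graphHSPHard_of_dlog h₁ (dlogSlopeBitsNotBPP_of_search ha hb)

/-! ## Decomposition C — base the hardness on `NP ⊄ BPP` (Brassard-type bridge) -/

/-- **T (Decomposition C).** `NP ⊄ BPP`. OPEN; strictly stronger than `P ≠ NP`; does NOT give
the summit (no NP-complete problem is known in BQP). -/
def NPNotSubsetBPP : Prop :=
  ¬ (Literature.Computability.Complexity.Nondeterministic.NP ⊆ BPP)

/-- **T → X (Decomposition C).** "Hidden-slope (DLOG-type) hardness can be based on `NP ⊄ BPP`."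
OPEN with NEGATIVE evidence: the slope bits are in `UP ∩ coUP`, so any proof by a (randomised,
adaptive) reduction from SAT puts `NP ⊆ BPP^{UP ∩ coUP}` and collapses PH (Brassard 1979;
Goldreich–Goldwasser 1998; Akavia–Goldreich–Goldwasser–Moshkovitz 2006; Bogdanov–Trevisan 2006).
No non-black-box approach is known. -/
def HardnessFromNP : Prop :=
  NPNotSubsetBPP → GraphHSPHard

/-- Assembly C (modus ponens). -/
theorem graphHSPHard_of_np (h₁ : NPNotSubsetBPP) (h₂ : HardnessFromNP) : GraphHSPHard :=
  h₂ h₁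

/-! ## Decomposition E — bridge split through the class form of the summit -/

/-- **T (Decomposition E).** `BQP ≠ BPP` (class form; `BQPEqBPP` is the tree's `@[conjecture]`). -/
def ClassSeparation : Prop :=
  ¬ Literature.Computability.QuantumComplexity.BQPEqBPP

/-- **T → X (Decomposition E).** "Any quantum advantage yields a hard hidden graph subgroup" — the
route's necessity thesis at FULL generality (not only single-Fourier-layer FH₂). OPEN and
implausible as stated (advantage need not be abelian-HSP-shaped: Childs–Schulman–Vazirani
hidden-radius laws, BQP-complete problems such as Jones-polynomial approximation). -/
def AdvantageIsCoset : Prop :=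
  QuantumAdvantage → GraphHSPHard

/-- (c) FAILS for E: `T ↔ S` is LANDED (`not_bqpEqBPP_iff_exists`, via `BPP ⊆ BQP`,
Bernstein–Vazirani Thm 8.3), so `T → X ≡ S → X` and the split is `S ∧ (S → X)`. -/
theorem classSeparation_iff_summit : ClassSeparation ↔ QuantumAdvantage :=
  Literature.Computability.QuantumComplexity.not_bqpEqBPP_iff_exists.trans Iff.rfl

/-- Assembly E (modus ponens through the landed iff). -/
theorem graphHSPHard_of_class (h₁ : ClassSeparation) (h₂ : AdvantageIsCoset) : GraphHSPHard :=
  h₂ (classSeparation_iff_summit.mp h₁)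

/-! ## Decomposition H — base the hardness on FACTORING (existing item `Shor.ShorThesis`, stmt-0231) -/

/-- **T → X (Decomposition H).** "If FACT ∉ BPP then some FP graph-hiding family has hard slope
bits" — would follow from a BPP-reduction of factoring to prime-field / prime-order-subgroup
DLOG, which is NOT known (known: DLOG modulo a COMPOSITE N is factoring-hard, Bach 1984 — but a
composite-modulus family has no FP-computable group order `Nf`, so it is not a `HidesGraph`
instance). OPEN, no plan. -/
def HardnessFromFactoring : Prop :=
  Summit.QuantumAdvantage.QuantumAdvantage.Theses.Shor.ShorThesis → GraphHSPHard

/-- (c) FAILS for H: `T → S` is a one-liner from the LANDED Shor theorem `FACT_mem_BQP_holds`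
(this was route Shor's deciding theorem; route closed `exhausted` 2026-08-16 for exactly this
reason).  Stated as an `example` (no declaration: this workfile credits nothing). -/
example (h : Summit.QuantumAdvantage.QuantumAdvantage.Theses.Shor.ShorThesis) : QuantumAdvantage :=
  ⟨_, Literature.Computability.Cryptography.FACT_mem_BQP_holds, h⟩

/-- Assembly H (modus ponens). -/
theorem graphHSPHard_of_factoring (h₁ : Summit.QuantumAdvantage.QuantumAdvantage.Theses.Shor.ShorThesis)
    (h₂ : HardnessFromFactoring) : GraphHSPHard :=
  h₂ h₁

/-! ## Decomposition I — STRENGTHEN the hardness piece to circuits (`∉ P/poly`) -/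

/-- **X₂⁺ (Decomposition I / census §Strengthen).** The slope bits need super-polynomial
circuits. OPEN; strictly stronger than `DLogSlopeBitsNotBPP` via the landed `BPP ⊆ P/poly`
(Adleman; `BPP_subset_PPoly_holds`); self-defeating for NATURAL proofs: if true, Blum–Micali /
GGM give pseudorandom functions against P/poly, so no P/poly-natural property proves it
(Razborov–Rudich 1997 Thm 4.1; tree barrier `Literature.Barriers.QuantumAdvantage.NaturalProofs`). -/
def DLogSlopeBitsNotPPoly : Prop :=
  slopeBits dlogSlope ∉ PPoly

/-- The strengthening is one (landed) step above the BPP form. -/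
theorem dlogSlopeBitsNotBPP_of_ppoly (h : DLogSlopeBitsNotPPoly) : DLogSlopeBitsNotBPP :=
  fun hB => h (Literature.Computability.Complexity.BPP_subset_PPoly_holds hB)

/-- Assembly I. -/
theorem graphHSPHard_of_ppoly (h₁ : DLogGraphHiding) (h₂ : DLogSlopeBitsNotPPoly) : GraphHSPHard :=
  graphHSPHard_of_dlog h₁ (dlogSlopeBitsNotBPP_of_ppoly h₂)

/-! ## Decomposition J — bridge through the WEAKEST UNKNOWN CONSEQUENCE `PP ⊄ BPP` (lens `wuc`) -/

/-- **T (Decomposition J).** `PP ⊄ BPP` — a NECESSARY condition for the summit (landed: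
`not_PP_subset_BPP_of_witness` with `BQP_subset_PP_holds`, Adleman–DeMarrais–Huang), open,
and not known to give the summit. -/
def CountingSeparation : Prop :=
  ¬ (Literature.Computability.Complexity.PP ⊆ BPP)

/-- The consequence direction is landed (recorded for BC2: a piece implied by S). -/
theorem summit_gives_countingSeparation (h : QuantumAdvantage) : CountingSeparation :=
  Literature.Barriers.QuantumAdvantage.not_PP_subset_BPP_of_witness
    Literature.Computability.QuantumComplexity.BQP_subset_PP_holds h

/-- **T → X (Decomposition J).** "Hidden-slope hardness from the mere non-collapse `PP ⊄ BPP`."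
OPEN, no approach (it would in particular give the converse floor `PP ⊄ BPP → BQP ⊄ BPP`). -/
def HardnessFromCounting : Prop :=
  CountingSeparation → GraphHSPHard

/-- Assembly J (modus ponens). -/
theorem graphHSPHard_of_counting (h₁ : CountingSeparation) (h₂ : HardnessFromCounting) : GraphHSPHard :=
  h₂ h₁

/-! ## Negation side — the floor any counterexample must break

Trying to REFUTE `GraphHSPHard` means putting the slope bits of EVERY FP exact-hiding family in
BPP.  Exact hiding makes slopes efficiently VERIFIABLE (`F ⟨x,⟨d',1⟩⟩ = F ⟨x,⟨0,0⟩⟩ ↔ d' = d x`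
for `d' < Nf x`), so every `slopeBits d` with `HidesGraph F Nf d` lies in `UP ∩ coUP`; a
refutation is therefore at least `UP ∩ coUP`-vs-`BPP` dequantisation strength for these
families, and conversely the crux implies `UP ∩ coUP ⊄ BPP` (hence `P ≠ NP`).  The membership
statement below is the usable lemma (provable-now, size M: two FP verifiers); it is a FLOOR
(barrier note), not a stub toward the crux. -/

/-- Exact hiding ⇒ unambiguous certificates: the slope-bit language of any FP exact-hiding
family is in `UP ∩ coUP`. (Typed here; candidate `Negative/` lemma for the standing disprover.) -/
def ExactHidingFloor : Prop :=
  ∀ (F : List Bool → List Bool) (Nf d : List Bool → ℕ), HidesGraph F Nf d → slopeBits d ∈ UP ∩ coUP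

/-- Given the floor lemma, the crux separates `UP ∩ coUP` from `BPP`. -/
theorem not_UP_inter_coUP_subset_BPP_of_floor (hfl : ExactHidingFloor) (hX : GraphHSPHard) :
    ¬ (UP ∩ coUP ⊆ BPP) := by
  obtain ⟨F, Nf, d, hH, hnot⟩ := graphHSPHard_iff.mp hX
  exact fun hsub => hnot (hsub (hfl F Nf d hH))

end Summit.QuantumAdvantage.QuantumAdvantage.Cruxes.GraphHSPHard.Decomp

end
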